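import Literature.NumberTheory.GelbartRogawski1991.LocalDoubledGaloisConjSiegel
import Literature.NumberTheory.GelbartRogawski1991.LocalGaloisConjCentreDet
import Literature.RepresentationTheory.TwistedCoinvariants
import HarnessLib

/-!
# `g ↦ ḡ` and the `χ`-coinvariants under the centre: `π_χ ∘ bar` is the `χ⁻¹`-coinvariant representation of `ω ∘ bar`

Topic `NumberTheory/GelbartRogawski1991`; namespaces `Literature.NumberTheory.Automorphic.UnitaryGroup` (§1–§2: ★ `localPiGalConj`, `localCenter`)
and `Literature.RepresentationTheory.TwistedCoinv` (§3).  KERNEL ONLY: theorems; no definition, no named fact, no `sorry`.  Cell `hodgecm-mathlib`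
(D-0151), programme P5 (crux HLiu418 = stmt-HodgeConjecture-24832), stone **L4** of the road card `F0/P5/A-p18/g23/ROAD-L4if-v2.A-p18g23.md`
(step (M1), representation level): how the conjugate `g ↦ π(ḡ)` of a theta-type representation `π = (ω)_{Z,χ}` (the `χ`-coinvariants of a
representation `ω` of `U(J)(F_v)` under its centre `Z = E_v¹ = U(J₁)(F_v)`, ★ `TwistedCoinv.rep`) is again a coinvariant representation.

THE MATHEMATICS ([MoeglinVignerasWaldspurger1987, Chap. 2 II.2, Chap. 3 IV]; [Liu2021, App. D §D.1 Step 3]).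
* §1 `bar` commutes with the centre embedding `Z →* U(J)(F_v)`, `u ↦ u · 1_N` (★ `localCenter`), for EVERY `u ∈ Z` (L2′ gave the norm-one
  scalars): `bar_N (u · 1_N) = (bar₁ u) · 1_N` (`localPiGalConj_localCenter`) — componentwise `c_*` at `c⁻¹w` (★ P1a `coe_localPiGalConj_apply`).
* §2 On `Z = U(J₁)(F_v)` itself `bar₁` is inversion (★ L2′ `localGalConj_eq_inv_rankOne`, transported to the factor form:
  `localPiGalConj_eq_inv_rankOne`).
* §3 Hence the relation submodules agree: `span{ω(bar(u·1))v − χ(bar₁ u)v} = span{ω(u·1)v − χ(u)v}` (`bar₁` is a bijection;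
  `ker_comp_localPiGalConj_eq`), so on the COMMON quotient the representation `rep (χ ∘ bar₁) (ω ∘ bar)` IS `g ↦ rep χ ω (ḡ)`
  (`rep_comp_localPiGalConj_apply`, through `Submodule.quotEquivOfEq`, the identity on classes): **`π_χ^{bar} = (ω ∘ bar)_{Z, χ∘bar₁} = (ω ∘ bar)_{Z, χ⁻¹}`**.
  With ★ `proj_comp_localPiGalConj` (`ω_s ∘ bar = ω_{s∘bar}`, a Weil representation for `−δ`) this is step (M1) of the road: the conjugate of a theta
  lift from the line `a` is a theta lift from the line `−a` with the inverse central character.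
Nothing of the cited sources is asserted; HC_CM is proved only modulo the printed citations until rung 0 closes.

## References
* [MoeglinVignerasWaldspurger1987] C. Mœglin, M.-F. Vignéras, J.-L. Waldspurger, LNM 1291 (1987), Chap. 2 II.2; Chap. 3 IV (the `(U(1), U(V))` lift as
  coinvariants under the compact member).
* [Liu2021] Y. Liu, Camb. J. Math. 9 (2021), App. D §D.1 Step 3 (l. 5221) («the maximal quotient … on which the centre acts by `χ`»).
-/

set_option autoImplicit false

noncomputable section

open NumberField IsDedekindDomain Matrix
open Literature.NumberTheory.GelbartRogawski1991.UnitaryDualPair.LocalSplitting (coe_localPiGalConj_apply)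

namespace Literature.NumberTheory.Automorphic.UnitaryGroup

variable {F : Type} (E : Type) [Field F] [NumberField F] [Field E] [NumberField E] [Algebra F E]
variable (c : E ≃ₐ[F] E) (N : ℕ) {T : Matrix (Fin N) (Fin N) F} {J : Matrix (Fin N) (Fin N) E}
  {T₁ : Matrix (Fin 1) (Fin 1) F} {J₁ : Matrix (Fin 1) (Fin 1) E} (v : HeightOneSpectrum (𝓞 F))

/-! ## §1 `bar` commutes with the centre embedding -/

/-- **`bar_N (u · 1_N) = (bar₁ u) · 1_N`** for every `u` in the rank-one group `Z = U(J₁)(F_v)` (both lines `F`-rational).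
[cite: MoeglinVignerasWaldspurger1987, Chap. 2 II.2] -/
theorem localPiGalConj_localCenter (hJ : J = T.map (algebraMap F E)) (hJ₁ : J₁ = T₁.map (algebraMap F E)) (hJ₁0 : J₁ 0 0 ≠ 0)
    (u : localPi E c 1 J₁ v) :
    localPiGalConj E c N v hJ (localCenter E c N J J₁ hJ₁0 v u) = localCenter E c N J J₁ hJ₁0 v (localPiGalConj E c 1 v hJ₁ u) := by
  refine Subtype.ext (funext fun w => Units.ext ?_)
  rw [coe_localPiGalConj_apply F E c v hJ, coe_localCenter, coe_localCenter, coe_localScalarGL_apply, coe_localScalarGL_apply,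
    map_smul_one, coe_localPiGalConj_apply F E c v hJ₁, Matrix.map_apply]

/-! ## §2 On the rank-one group `bar` is inversion (factor form) -/

/-- **`bar₁ u = u⁻¹` on `U(J₁)(F_v)` in factor form** (★ `localGalConj_eq_inv_rankOne` through ★ `localPiEquiv`).
[cite: MoeglinVignerasWaldspurger1987, Chap. 2 II.2] -/
theorem localPiGalConj_eq_inv_rankOne (hT₁ : IsUnit T₁.det) (hJ₁ : J₁ = T₁.map (algebraMap F E)) (u : localPi E c 1 J₁ v) :
    localPiGalConj E c 1 v hJ₁ u = u⁻¹ := by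
  apply (localPiEquiv E c 1 J₁ v).injective
  rw [localPiEquiv_localPiGalConj, localGalConj_eq_inv_rankOne E c v hT₁ hJ₁, map_inv]

/-- `bar₁` is a bijection of `Z` (an involution). [cite: MoeglinVignerasWaldspurger1987, Chap. 2 II.2] -/
theorem localPiGalConj_rankOne_surjective (hT₁ : IsUnit T₁.det) (hJ₁ : J₁ = T₁.map (algebraMap F E)) :
    Function.Surjective (localPiGalConj E c 1 v hJ₁) := fun u =>
  ⟨u⁻¹, by rw [localPiGalConj_eq_inv_rankOne E c v hT₁ hJ₁, inv_inv]⟩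

end Literature.NumberTheory.Automorphic.UnitaryGroup

/-! ## §3 Coinvariants under the centre, pulled back along `bar` -/

namespace Literature.RepresentationTheory.TwistedCoinv

open Literature.NumberTheory.Automorphic Literature.NumberTheory.Automorphic.UnitaryGroup

variable {F : Type} {E : Type} [Field F] [NumberField F] [Field E] [NumberField E] [Algebra F E]
variable {c : E ≃ₐ[F] E} {N : ℕ} {T : Matrix (Fin N) (Fin N) F} {J : Matrix (Fin N) (Fin N) E}
  {T₁ : Matrix (Fin 1) (Fin 1) F} {J₁ : Matrix (Fin 1) (Fin 1) E} {v : HeightOneSpectrum (𝓞 F)}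
  {S : Type*} [AddCommGroup S] [Module ℂ S]

/-- A representation of `U(J)(F_v)` commuting with its centre still commutes after composing both with `bar`.
[cite: MoeglinVignerasWaldspurger1987, Chap. 2 II.2] -/
theorem commute_comp_localPiGalConj (hJ : J = T.map (algebraMap F E)) (hJ₁0 : J₁ 0 0 ≠ 0)
    (ω : Representation ℂ (localPi E c N J v) S) (g : localPi E c N J v) (u : localPi E c 1 J₁ v) :
    Commute ((ω.comp (localPiGalConj E c N v hJ)) g) (((ω.comp (localPiGalConj E c N v hJ)).comp (localCenter E c N J J₁ hJ₁0 v)) u) := by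
  simp only [MonoidHom.comp_apply]
  refine Commute.map ?_ ω
  refine Commute.map ?_ (localPiGalConj E c N v hJ)
  exact localCenter_comm E c N J J₁ hJ₁0 v u g

/-- **The relation submodules agree**: `span {ω(bar(u·1)) v − χ(bar₁ u) v} = span {ω(u·1) v − χ(u) v}` — `bar` commutes with the centre
embedding and `bar₁` is a bijection of `Z`. [cite: MoeglinVignerasWaldspurger1987, Chap. 2 II.2] [cite: Liu2021, App. D §D.1 Step 3 (l. 5221)] -/
theorem ker_comp_localPiGalConj_eq (hJ : J = T.map (algebraMap F E)) (hT₁ : IsUnit T₁.det) (hJ₁ : J₁ = T₁.map (algebraMap F E))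
    (hJ₁0 : J₁ 0 0 ≠ 0) (ω : Representation ℂ (localPi E c N J v) S) (χ : localPi E c 1 J₁ v →* ℂˣ) :
    ker ((ω.comp (localPiGalConj E c N v hJ)).comp (localCenter E c N J J₁ hJ₁0 v)) (χ.comp (localPiGalConj E c 1 v hJ₁)) =
      ker (ω.comp (localCenter E c N J J₁ hJ₁0 v)) χ := by
  have hgen : ∀ (u : localPi E c 1 J₁ v) (x : S),
      ((ω.comp (localPiGalConj E c N v hJ)).comp (localCenter E c N J J₁ hJ₁0 v)) u x -
          (((χ.comp (localPiGalConj E c 1 v hJ₁)) u : ℂˣ) : ℂ) • x =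
        (ω.comp (localCenter E c N J J₁ hJ₁0 v)) (localPiGalConj E c 1 v hJ₁ u) x - ((χ (localPiGalConj E c 1 v hJ₁ u) : ℂˣ) : ℂ) • x := by
    intro u x
    simp only [MonoidHom.comp_apply, localPiGalConj_localCenter E c N v hJ hJ₁ hJ₁0]
  refine le_antisymm ?_ ?_
  · rw [ker, Submodule.span_le]
    rintro _ ⟨⟨u, x⟩, rfl⟩
    change ((ω.comp (localPiGalConj E c N v hJ)).comp (localCenter E c N J J₁ hJ₁0 v)) u x - _ ∈ _
    rw [hgen]
    exact sub_mem_ker _ χ _ x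
  · rw [ker, Submodule.span_le]
    rintro _ ⟨⟨u, x⟩, rfl⟩
    obtain ⟨u', rfl⟩ := localPiGalConj_rankOne_surjective E c v hT₁ hJ₁ u
    change (ω.comp (localCenter E c N J J₁ hJ₁0 v)) (localPiGalConj E c 1 v hJ₁ u') x - _ ∈ _
    rw [← hgen]
    exact sub_mem_ker _ _ u' x

/-- **`π_χ^{bar}` IS the coinvariant representation of `ω ∘ bar` for `χ ∘ bar₁ = χ⁻¹`**: on the common quotient (`Submodule.quotEquivOfEq` along
`ker_comp_localPiGalConj_eq`, the identity on classes) the representation `rep (χ ∘ bar₁) (ω ∘ bar)` acts as `g ↦ rep χ ω (ḡ)`.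
[cite: MoeglinVignerasWaldspurger1987, Chap. 2 II.2] [cite: Liu2021, App. D §D.1 Step 3 (l. 5221)] -/
theorem rep_comp_localPiGalConj_apply (hJ : J = T.map (algebraMap F E)) (hT₁ : IsUnit T₁.det) (hJ₁ : J₁ = T₁.map (algebraMap F E))
    (hJ₁0 : J₁ 0 0 ≠ 0) (ω : Representation ℂ (localPi E c N J v) S) (χ : localPi E c 1 J₁ v →* ℂˣ)
    (hc : ∀ (g : localPi E c N J v) (u : localPi E c 1 J₁ v), Commute (ω g) ((ω.comp (localCenter E c N J J₁ hJ₁0 v)) u))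
    (g : localPi E c N J v)
    (x : Coinv ((ω.comp (localPiGalConj E c N v hJ)).comp (localCenter E c N J J₁ hJ₁0 v)) (χ.comp (localPiGalConj E c 1 v hJ₁))) :
    Submodule.quotEquivOfEq _ _ (ker_comp_localPiGalConj_eq hJ hT₁ hJ₁ hJ₁0 ω χ)
        (rep (χ.comp (localPiGalConj E c 1 v hJ₁)) (ω.comp (localPiGalConj E c N v hJ)) (commute_comp_localPiGalConj hJ hJ₁0 ω) g x) =
      rep χ ω hc (localPiGalConj E c N v hJ g) (Submodule.quotEquivOfEq _ _ (ker_comp_localPiGalConj_eq hJ hT₁ hJ₁ hJ₁0 ω χ) x) := by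
  obtain ⟨y, rfl⟩ := mk_surjective _ _ x
  rfl

/-- The central character of the pulled-back coinvariants is `χ ∘ bar₁ = χ ∘ inv` (so `χ⁻¹` pointwise).
[cite: Liu2021, App. D §D.1 Step 3 (l. 5221)] -/
theorem comp_localPiGalConj_rankOne_apply (hT₁ : IsUnit T₁.det) (hJ₁ : J₁ = T₁.map (algebraMap F E)) (χ : localPi E c 1 J₁ v →* ℂˣ)
    (u : localPi E c 1 J₁ v) : (χ.comp (localPiGalConj E c 1 v hJ₁)) u = (χ u)⁻¹ := by
  rw [MonoidHom.comp_apply, localPiGalConj_eq_inv_rankOne E c v hT₁ hJ₁, map_inv]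

end Literature.RepresentationTheory.TwistedCoinv

end
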